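import Mathlib
import Literature.Computability.AlgebraicComplexity.MatrixMultiplicationExponent
import Literature.RingTheory.MvPolynomial.MultigradedHilbertFunction
import Summits.MatrixMultiplication.MatrixMultiplication.Theorems.FidelityWitnessesFidelityGapThreeSeventeenPunctualDefs

/-!
# `FidelityWitnesses.FidelityGapThreeSeventeen` (stmt-MatrixMultiplication-4958), line `punctual-saturation`:
# stub `stub_punctual` — Borel-stable candidates are supported at the flag point

Crux `stmt-MatrixMultiplication-4958`, line `punctual-saturation`, registered stub `stub_punctual`
(`∀ I, IsCandidate I → IsBorelStable I → IsPunctual I`), proved against the vocabulary of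
`Theorems/FidelityWitnessesFidelityGapThreeSeventeenPunctualDefs.lean` (namespace
`Summit.MatrixMultiplication.MatrixMultiplication.Theorems.PunctualSaturation`).

THE STATEMENT. `S = ℂ[C ⊕ A ⊕ B]` (`27` variables `(s,i,j)`), `I ⊂ S` an ideal with the generic trigraded Hilbert
function of `17` points (`HasGenericHF`, from `IsCandidate`) which is stable under the Borel substitutions
`borelSubst P Q R` (`IsBorelStable`). Then every non-corner coordinate `X v`, `v ∉ {(0,2,0),(1,0,2),(2,0,2)}`
(`cornerVar`), lies in `√(I^{sat})` (`IsPunctual I`). Only `HasGenericHF` and `IsBorelStable` are used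
(trihomogeneity and apolarity are not needed).

THE PROOF (elementary; affine cone `ℂ²⁷ ⊃ V(I) = zeroLocus ℂ I`). We prove the stronger `X v ∈ √I` and use
`I ≤ I^{sat}` (`le_satur`).
1. Nullstellensatz (Mathlib `MvPolynomial.vanishingIdeal_zeroLocus_eq_radical`, `σ = Var` finite, `k = K = ℂ`):
   it suffices that `x v = 0` for every `x ∈ V(I)`.
2. The substitution `borelSubst P Q R = aeval (borelVar P Q R)` is dual to the action on points
   `x ↦ (v ↦ (borelVar P Q R v)(x))`, so `V(I)` is stable under the point action of upper-unit `(P,Q,R)`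
   (`act_mem_zeroLocus`).
3. For the elementary unipotents `Matrix.transvection p q t = 1 + t E_{pq}`, `p < q` (upper unitriangular,
   inverse `transvection p q (-t)`), the point action is AFFINE in `t`: `x ↦ x + t·y` with an explicit velocity
   `y` on each slot (`actP_zero`, `actP_one`, `actQ_one`, `actQ_two`, `actR_zero`, `actR_two`).
4. EIGHTEEN DIRECTIONS ARE TOO MANY (`no_eighteen_directions`): `V(I)` contains no `18` points whose slot-`s`
   components are pairwise non-proportional — products of `17` separating linear forms give `F_k ∈ S_{17e_s}` with
   `F_k(x_l) = δ_{kl}·c_k`, `c_k ≠ 0`, so evaluation `S_{17e_s} → ℂ¹⁸` is onto and kills `I_{17e_s}`, whence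
   `dim I_D + 18 ≤ dim S_D`, contradicting `dim I_D + min(17, dim S_D) = dim S_D`.
5. LINE LEMMA (`minor_eq_zero_of_line`): if `t ↦ γ t ∈ V(I)` is affine on slot `s`, `γ t = x + t y` there, then all
   `2×2` minors of `(x_s, y)` vanish (else `t = 0,…,17` give `18` directions).
6. With the velocities of step 3 the vanishing minors read `x(0,p,·) = x(0,·,q) = x(1,q,·) = x(1,·,p) =
   x(2,q,·) = x(2,·,p) = 0` for all `p < q`, i.e. `[x_C] = [E₂₀]`, `[x_A] = [E₀₂]`, `[x_B] = [E₀₂]`: every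
   non-corner coordinate vanishes on `V(I)` (`coord_eq_zero`) — the Borel fixed-line computation
   `BorelFixedLineMatrixThree` of the idea card, done on points.

Sources: A. Borel's fixed point theorem in the finite (zero-dimensional) case is replaced by the counting argument
4–5; W. Buczyńska, J. Buczyński, Duke Math. J. 170 (2021) Thm 4.3 (Borel-fixed border apolarity) for context only.
No new definitions; no named facts; nothing about the other stubs of the line.
-/

noncomputable section

namespace Summit.MatrixMultiplication.MatrixMultiplication.Theorems.PunctualSaturation

-- single-conjunct summit: the `Summit.<S>.<P>` prefix repeats `MatrixMultiplication` by design (D-0017)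
set_option linter.dupNamespace false

open scoped BigOperators
open MvPolynomial

/-! ## The point action dual to `borelSubst` and the stability of `V(I)` -/

/-- `f ∘ g` evaluated at `x` is `f` evaluated at `g • x`, where `(g • x)_v = (borelVar P Q R v)(x)`. [folklore] -/
theorem aeval_borelSubst (P Q R : Matrix (Fin 3) (Fin 3) ℂ) (x : Var → ℂ) (f : S) :
    aeval x (borelSubst P Q R f) = aeval (fun v => aeval x (borelVar P Q R v)) f :=
  comp_aeval_apply (borelVar P Q R) (aeval x) f

/-- `V(I)` is stable under the point action of the Borel subgroup when `I` is Borel-stable. [folklore] -/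
theorem act_mem_zeroLocus {I : Ideal S} (hB : IsBorelStable I) {P Q R : Matrix (Fin 3) (Fin 3) ℂ}
    (hP : IsUpperUnit P) (hQ : IsUpperUnit Q) (hR : IsUpperUnit R) {x : Var → ℂ}
    (hx : x ∈ zeroLocus ℂ I) : (fun v => aeval x (borelVar P Q R v)) ∈ zeroLocus ℂ I := by
  intro f hf
  rw [← aeval_borelSubst]
  exact hx _ (hB P Q R hP hQ hR f hf)

/-- The point action on the `C` slot: `c ↦ P⁻ᵀ c R⁻ᵀ`, in coordinates. [folklore] -/
theorem act_apply_zero (P Q R : Matrix (Fin 3) (Fin 3) ℂ) (x : Var → ℂ) (i j : Fin 3) :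
    aeval x (borelVar P Q R (0, i, j)) = ∑ i', ∑ j', (P⁻¹) i' i * (R⁻¹) j j' * x (0, i', j') := by
  simp [borelVar, map_sum]

/-- The point action on the `A` slot: `a ↦ P a Q`, in coordinates. [folklore] -/
theorem act_apply_one (P Q R : Matrix (Fin 3) (Fin 3) ℂ) (x : Var → ℂ) (i j : Fin 3) :
    aeval x (borelVar P Q R (1, i, j)) = ∑ i', ∑ j', P i i' * Q j' j * x (1, i', j') := by
  simp [borelVar, map_sum]

/-- The point action on the `B` slot: `b ↦ Q⁻¹ b R`, in coordinates. [folklore] -/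
theorem act_apply_two (P Q R : Matrix (Fin 3) (Fin 3) ℂ) (x : Var → ℂ) (i j : Fin 3) :
    aeval x (borelVar P Q R (2, i, j)) = ∑ i', ∑ j', (Q⁻¹) i i' * R j' j * x (2, i', j') := by
  simp [borelVar, map_sum]

/-! ## Elementary unipotent substitutions `transvection p q t = 1 + t E_{pq}`, `p < q` -/

/-- The identity matrix is upper triangular and invertible. [folklore] -/
theorem isUpperUnit_one : IsUpperUnit (1 : Matrix (Fin 3) (Fin 3) ℂ) :=
  ⟨fun _ _ h => Matrix.one_apply_ne (ne_of_gt h), by simp⟩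

/-- `1 + t E_{pq}` with `p < q` is upper triangular with determinant `1`. [folklore] -/
theorem isUpperUnit_transvection {p q : Fin 3} (hpq : p < q) (t : ℂ) :
    IsUpperUnit (Matrix.transvection p q t) := by
  refine ⟨fun i j hji => ?_, by rw [Matrix.det_transvection_of_ne _ _ hpq.ne]; exact isUnit_one⟩
  have hij : i ≠ j := ne_of_gt hji
  have hpq' : ¬ (p = i ∧ q = j) := fun h => by
    rcases h with ⟨rfl, rfl⟩; exact lt_asymm hpq hji
  simp [Matrix.transvection, hij, hpq']

/-- `(1 + t E_{pq})⁻¹ = 1 - t E_{pq}` for `p ≠ q`. [folklore] -/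
theorem transvection_inv {p q : Fin 3} (hpq : p ≠ q) (t : ℂ) :
    (Matrix.transvection p q t)⁻¹ = Matrix.transvection p q (-t) := by
  apply Matrix.inv_eq_right_inv
  rw [Matrix.transvection_mul_transvection_same _ _ hpq, add_neg_cancel, Matrix.transvection_zero]

/-- Row `i` of `1 + c E_{pq}` against a vector: `g i + [i = p] c g q`. [folklore] -/
theorem sum_transvection_row (p q i : Fin 3) (c : ℂ) (g : Fin 3 → ℂ) :
    ∑ k, Matrix.transvection p q c i k * g k = g i + if i = p then c * g q else 0 := by
  by_cases hip : i = p
  · subst hip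
    simp [Matrix.transvection, Matrix.one_apply, Matrix.single_apply, add_mul, Finset.sum_add_distrib]
  · simp [Matrix.transvection, Matrix.one_apply, hip, Ne.symm hip]

/-- Column `i` of `1 + c E_{pq}` against a vector: `g i + [i = q] c g p`. [folklore] -/
theorem sum_transvection_col (p q i : Fin 3) (c : ℂ) (g : Fin 3 → ℂ) :
    ∑ k, Matrix.transvection p q c k i * g k = g i + if i = q then c * g p else 0 := by
  by_cases hiq : i = q
  · subst hiq
    simp [Matrix.transvection, Matrix.one_apply, Matrix.single_apply, add_mul, Finset.sum_add_distrib]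
  · simp [Matrix.transvection, Matrix.one_apply, hiq, Ne.symm hiq]

/-- Collapse of a double sum against the identity matrix (right index, pattern `1 j j'`). [folklore] -/
theorem sum_sum_one_right (A : Fin 3 → ℂ) (g : Fin 3 → Fin 3 → ℂ) (j : Fin 3) :
    ∑ i', ∑ j', A i' * (1 : Matrix (Fin 3) (Fin 3) ℂ) j j' * g i' j' = ∑ i', A i' * g i' j := by
  simp [Matrix.one_apply]

/-- Collapse of a double sum against the identity matrix (right index, pattern `1 j' j`). [folklore] -/
theorem sum_sum_one_right' (A : Fin 3 → ℂ) (g : Fin 3 → Fin 3 → ℂ) (j : Fin 3) :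
    ∑ i', ∑ j', A i' * (1 : Matrix (Fin 3) (Fin 3) ℂ) j' j * g i' j' = ∑ i', A i' * g i' j := by
  simp [Matrix.one_apply]

/-- Collapse of a double sum against the identity matrix (left index, pattern `1 i i'`). [folklore] -/
theorem sum_sum_one_left (B : Fin 3 → ℂ) (g : Fin 3 → Fin 3 → ℂ) (i : Fin 3) :
    ∑ i', ∑ j', (1 : Matrix (Fin 3) (Fin 3) ℂ) i i' * B j' * g i' j' = ∑ j', B j' * g i j' := by
  simp [Matrix.one_apply]

/-- Collapse of a double sum against the identity matrix (left index, pattern `1 i' i`). [folklore] -/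
theorem sum_sum_one_left' (B : Fin 3 → ℂ) (g : Fin 3 → Fin 3 → ℂ) (i : Fin 3) :
    ∑ i', ∑ j', (1 : Matrix (Fin 3) (Fin 3) ℂ) i' i * B j' * g i' j' = ∑ j', B j' * g i j' := by
  simp [Matrix.one_apply]

/-- `P`-family `(1 + tE_{pq}, 1, 1)` on the `C` slot (`c ↦ P⁻ᵀ c`): row `q` moves by `-t·(row p)`. [folklore] -/
theorem actP_zero {p q : Fin 3} (hpq : p ≠ q) (t : ℂ) (x : Var → ℂ) (i j : Fin 3) :
    aeval x (borelVar (Matrix.transvection p q t) 1 1 (0, i, j)) =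
      x (0, i, j) + t * (if i = q then -x (0, p, j) else 0) := by
  rw [act_apply_zero, transvection_inv hpq, inv_one,
    sum_sum_one_right (fun i' => Matrix.transvection p q (-t) i' i) (fun i' j' => x (0, i', j')) j,
    sum_transvection_col]
  split_ifs <;> ring

/-- `P`-family on the `A` slot (`a ↦ P a`): row `p` moves by `t·(row q)`. [folklore] -/
theorem actP_one (p q : Fin 3) (t : ℂ) (x : Var → ℂ) (i j : Fin 3) :
    aeval x (borelVar (Matrix.transvection p q t) 1 1 (1, i, j)) =
      x (1, i, j) + t * (if i = p then x (1, q, j) else 0) := by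
  rw [act_apply_one,
    sum_sum_one_right' (fun i' => Matrix.transvection p q t i i') (fun i' j' => x (1, i', j')) j,
    sum_transvection_row]
  split_ifs <;> ring

/-- `Q`-family `(1, 1 + tE_{pq}, 1)` on the `A` slot (`a ↦ a Q`): column `q` moves by `t·(column p)`. [folklore] -/
theorem actQ_one (p q : Fin 3) (t : ℂ) (x : Var → ℂ) (i j : Fin 3) :
    aeval x (borelVar 1 (Matrix.transvection p q t) 1 (1, i, j)) =
      x (1, i, j) + t * (if j = q then x (1, i, p) else 0) := by
  rw [act_apply_one,
    sum_sum_one_left (fun j' => Matrix.transvection p q t j' j) (fun i' j' => x (1, i', j')) i,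
    sum_transvection_col]
  split_ifs <;> ring

/-- `Q`-family on the `B` slot (`b ↦ Q⁻¹ b`): row `p` moves by `-t·(row q)`. [folklore] -/
theorem actQ_two {p q : Fin 3} (hpq : p ≠ q) (t : ℂ) (x : Var → ℂ) (i j : Fin 3) :
    aeval x (borelVar 1 (Matrix.transvection p q t) 1 (2, i, j)) =
      x (2, i, j) + t * (if i = p then -x (2, q, j) else 0) := by
  rw [act_apply_two, transvection_inv hpq,
    sum_sum_one_right' (fun i' => Matrix.transvection p q (-t) i i') (fun i' j' => x (2, i', j')) j,
    sum_transvection_row]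
  split_ifs <;> ring

/-- `R`-family `(1, 1, 1 + tE_{pq})` on the `C` slot (`c ↦ c R⁻ᵀ`): column `p` moves by `-t·(column q)`.
[folklore] -/
theorem actR_zero {p q : Fin 3} (hpq : p ≠ q) (t : ℂ) (x : Var → ℂ) (i j : Fin 3) :
    aeval x (borelVar 1 1 (Matrix.transvection p q t) (0, i, j)) =
      x (0, i, j) + t * (if j = p then -x (0, i, q) else 0) := by
  rw [act_apply_zero, transvection_inv hpq, inv_one,
    sum_sum_one_left' (fun j' => Matrix.transvection p q (-t) j j') (fun i' j' => x (0, i', j')) i,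
    sum_transvection_row]
  split_ifs <;> ring

/-- `R`-family on the `B` slot (`b ↦ b R`): column `q` moves by `t·(column p)`. [folklore] -/
theorem actR_two (p q : Fin 3) (t : ℂ) (x : Var → ℂ) (i j : Fin 3) :
    aeval x (borelVar 1 1 (Matrix.transvection p q t) (2, i, j)) =
      x (2, i, j) + t * (if j = q then x (2, i, p) else 0) := by
  rw [act_apply_two, inv_one,
    sum_sum_one_left (fun j' => Matrix.transvection p q t j' j) (fun i' j' => x (2, i', j')) i,
    sum_transvection_col]
  split_ifs <;> ring

/-! ## Eighteen directions are too many -/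

open Module in
/-- If `I` has the generic Hilbert function of `17` points then `V(I)` does not contain `18` points whose
slot-`s` components are pairwise non-proportional: products of `17` separating linear forms are `18` forms of
multidegree `17·e_s` on which the `18` evaluations are a surjection killing `I_{17 e_s}`, so
`dim I_D + 18 ≤ dim S_D = dim I_D + 17`. [folklore] -/
theorem no_eighteen_directions {I : Ideal S} (hI : HasGenericHF I) (s : Fin 3)
    (pts : Fin 18 → Var → ℂ) (hV : ∀ k, pts k ∈ zeroLocus ℂ I)
    (hsep : ∀ k l, k ≠ l → ∃ ab : (Fin 3 × Fin 3) × (Fin 3 × Fin 3),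
      pts l (s, ab.1) * pts k (s, ab.2) - pts l (s, ab.2) * pts k (s, ab.1) ≠ 0) : False := by
  classical
  choose! ab hab using hsep
  -- separating linear forms `ℓ k l` (vanishing at `pts l`, not at `pts k`) and their products `F k`
  set ℓ : Fin 18 → Fin 18 → S := fun k l =>
    C (pts l (s, (ab k l).1)) * X (s, (ab k l).2) - C (pts l (s, (ab k l).2)) * X (s, (ab k l).1) with hℓ
  set F : Fin 18 → S := fun k => ∏ l ∈ Finset.univ.erase k, ℓ k l with hF
  set D : Fin 3 → ℕ := (17 : ℕ) • (Pi.single s 1 : Fin 3 → ℕ) with hD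
  have hℓ_hom : ∀ k l, IsWeightedHomogeneous wt (ℓ k l) (Pi.single s 1 : Fin 3 → ℕ) := by
    intro k l
    rw [← mem_weightedHomogeneousSubmodule]
    refine Submodule.sub_mem _ ?_ ?_ <;> rw [← smul_eq_C_mul] <;>
      refine Submodule.smul_mem _ _ ?_ <;> rw [mem_weightedHomogeneousSubmodule] <;>
      exact isWeightedHomogeneous_X ℂ wt _
  have hFD : ∀ k, F k ∈ SD D := by
    intro k
    rw [mem_weightedHomogeneousSubmodule]
    have h := IsWeightedHomogeneous.prod (Finset.univ.erase k) (ℓ k)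
      (fun _ => (Pi.single s 1 : Fin 3 → ℕ)) (fun l _ => hℓ_hom k l)
    rwa [Finset.sum_const, Finset.card_erase_of_mem (Finset.mem_univ k), Finset.card_univ,
      Fintype.card_fin] at h
  have hℓ_self : ∀ k l, aeval (pts l) (ℓ k l) = 0 := by
    intro k l; simp only [hℓ, map_sub, map_mul, aeval_C, aeval_X]; simp; ring
  have hℓ_ne : ∀ k l, k ≠ l → aeval (pts k) (ℓ k l) ≠ 0 := by
    intro k l hkl
    simp only [hℓ, map_sub, map_mul, aeval_C, aeval_X]
    simpa using hab k l hkl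
  have hF_ne : ∀ k, aeval (pts k) (F k) ≠ 0 := by
    intro k
    rw [hF, map_prod]
    exact Finset.prod_ne_zero_iff.mpr fun l hl => hℓ_ne k l (Finset.ne_of_mem_erase hl).symm
  have hF_eq : ∀ k l, k ≠ l → aeval (pts l) (F k) = 0 := by
    intro k l hkl
    rw [hF, map_prod]
    exact Finset.prod_eq_zero (Finset.mem_erase.mpr ⟨fun h => hkl h.symm, Finset.mem_univ _⟩)
      (hℓ_self k l)
  -- dimension count inside the finite-dimensional piece `S_D`
  haveI : Module.Finite ℂ ↥(SD D) :=
    Literature.RingTheory.MvPolynomial.finite_weightedHomogeneousSubmodule_of_ne_zero wt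
      (fun v h => by simpa [wt] using congr_fun h v.1) D
  let E : S →ₗ[ℂ] (Fin 18 → ℂ) := LinearMap.pi fun k => (aeval (pts k) : S →ₐ[ℂ] ℂ).toLinearMap
  let E' : ↥(SD D) →ₗ[ℂ] (Fin 18 → ℂ) := E ∘ₗ (SD D).subtype
  have hE' : ∀ f : ↥(SD D), ∀ k, E' f k = aeval (pts k) (f : S) := fun f k => rfl
  have hsurj : Function.Surjective E' := by
    intro w
    refine ⟨∑ k, (w k * (aeval (pts k) (F k))⁻¹) • ⟨F k, hFD k⟩, ?_⟩
    funext l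
    rw [map_sum, Finset.sum_apply, Finset.sum_eq_single l]
    · rw [map_smul, Pi.smul_apply, hE', smul_eq_mul, inv_mul_cancel_right₀ (hF_ne l)]
    · intro k _ hkl
      rw [map_smul, Pi.smul_apply, hE', smul_eq_mul]
      simp [hF_eq k l hkl]
    · intro h; exact absurd (Finset.mem_univ l) h
  have hrange : finrank ℂ ↥(LinearMap.range E') = 18 := by
    rw [LinearMap.range_eq_top.mpr hsurj, finrank_top, Module.finrank_fin_fun]
  have hker : hdim I D ≤ finrank ℂ ↥(LinearMap.ker E') := by
    have hle : (piece I D).comap (SD D).subtype ≤ LinearMap.ker E' := by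
      intro f hf
      rw [Submodule.mem_comap] at hf
      rw [LinearMap.mem_ker]
      funext k
      rw [hE']
      exact hV k _ hf.1
    calc hdim I D = finrank ℂ ↥((piece I D).comap (SD D).subtype) :=
          (Submodule.comapSubtypeEquivOfLe (inf_le_right : piece I D ≤ SD D)).finrank_eq.symm
      _ ≤ finrank ℂ ↥(LinearMap.ker E') := Submodule.finrank_mono hle
  have hrn := LinearMap.finrank_range_add_finrank_ker E'
  have hHF := hI D
  rw [min_eq_left (by omega : 17 ≤ finrank ℂ ↥(SD D))] at hHF
  omega

/-- THE LINE LEMMA. If a curve `t ↦ γ t` in `V(I)` is affine on slot `s`, `γ t = x + t·y` there, then all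
`2 × 2` minors of `(x_s, y)` vanish: otherwise `t = 0, …, 17` give `18` pairwise non-proportional directions,
against `no_eighteen_directions`. [folklore] -/
theorem minor_eq_zero_of_line {I : Ideal S} (hI : HasGenericHF I) (s : Fin 3) (γ : ℂ → Var → ℂ)
    (hγV : ∀ t, γ t ∈ zeroLocus ℂ I) (x : Var → ℂ) (y : Fin 3 × Fin 3 → ℂ)
    (hγ : ∀ t a, γ t (s, a) = x (s, a) + t * y a) (a b : Fin 3 × Fin 3) :
    x (s, a) * y b = x (s, b) * y a := by
  by_contra hne
  refine no_eighteen_directions hI s (fun k : Fin 18 => γ ((k : ℕ) : ℂ)) (fun k => hγV _) ?_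
  intro k l hkl
  refine ⟨(a, b), ?_⟩
  have hkl' : ((k : ℕ) : ℂ) ≠ ((l : ℕ) : ℂ) := by
    intro h'; exact hkl (Fin.ext (by exact_mod_cast h'))
  have : γ ((l : ℕ) : ℂ) (s, a) * γ ((k : ℕ) : ℂ) (s, b) - γ ((l : ℕ) : ℂ) (s, b) * γ ((k : ℕ) : ℂ) (s, a) =
      (((k : ℕ) : ℂ) - ((l : ℕ) : ℂ)) * (x (s, a) * y b - x (s, b) * y a) := by
    simp only [hγ]; ring
  rw [this]
  exact mul_ne_zero (sub_ne_zero.mpr hkl') (sub_ne_zero.mpr hne)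

/-! ## Extraction of the corner: the Borel-fixed lines of `ℂ^{3×3}` -/

section Corner

variable {I : Ideal S} (hI : HasGenericHF I) (hB : IsBorelStable I) {x : Var → ℂ}
  (hx : x ∈ zeroLocus ℂ I)
include hI hB hx

/-- `C` slot: the rows `p < 2` of `x_C` vanish on `V(I)` (`P`-family). [folklore] -/
theorem zero_row_eq_zero {p q : Fin 3} (hpq : p < q) (j : Fin 3) : x (0, p, j) = 0 := by
  have h := minor_eq_zero_of_line hI 0 _
    (fun t => act_mem_zeroLocus hB (isUpperUnit_transvection hpq t) isUpperUnit_one isUpperUnit_one hx)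
    x (fun a => if a.1 = q then -x (0, p, a.2) else 0) (fun t a => actP_zero hpq.ne t x a.1 a.2)
    (p, j) (q, j)
  simpa [hpq.ne] using h

/-- `C` slot: the columns `q > 0` of `x_C` vanish on `V(I)` (`R`-family). [folklore] -/
theorem zero_col_eq_zero {p q : Fin 3} (hpq : p < q) (i : Fin 3) : x (0, i, q) = 0 := by
  have h := minor_eq_zero_of_line hI 0 _
    (fun t => act_mem_zeroLocus hB isUpperUnit_one isUpperUnit_one (isUpperUnit_transvection hpq t) hx)
    x (fun a => if a.2 = p then -x (0, a.1, q) else 0) (fun t a => actR_zero hpq.ne t x a.1 a.2)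
    (i, q) (i, p)
  simpa [hpq.ne'] using h

/-- `A` slot: the rows `q > 0` of `x_A` vanish on `V(I)` (`P`-family). [folklore] -/
theorem one_row_eq_zero {p q : Fin 3} (hpq : p < q) (j : Fin 3) : x (1, q, j) = 0 := by
  have h := minor_eq_zero_of_line hI 1 _
    (fun t => act_mem_zeroLocus hB (isUpperUnit_transvection hpq t) isUpperUnit_one isUpperUnit_one hx)
    x (fun a => if a.1 = p then x (1, q, a.2) else 0) (fun t a => actP_one p q t x a.1 a.2)
    (q, j) (p, j)
  simpa [hpq.ne'] using h

/-- `A` slot: the columns `p < 2` of `x_A` vanish on `V(I)` (`Q`-family). [folklore] -/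
theorem one_col_eq_zero {p q : Fin 3} (hpq : p < q) (i : Fin 3) : x (1, i, p) = 0 := by
  have h := minor_eq_zero_of_line hI 1 _
    (fun t => act_mem_zeroLocus hB isUpperUnit_one (isUpperUnit_transvection hpq t) isUpperUnit_one hx)
    x (fun a => if a.2 = q then x (1, a.1, p) else 0) (fun t a => actQ_one p q t x a.1 a.2)
    (i, p) (i, q)
  simpa [hpq.ne] using h

/-- `B` slot: the rows `q > 0` of `x_B` vanish on `V(I)` (`Q`-family). [folklore] -/
theorem two_row_eq_zero {p q : Fin 3} (hpq : p < q) (j : Fin 3) : x (2, q, j) = 0 := by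
  have h := minor_eq_zero_of_line hI 2 _
    (fun t => act_mem_zeroLocus hB isUpperUnit_one (isUpperUnit_transvection hpq t) isUpperUnit_one hx)
    x (fun a => if a.1 = p then -x (2, q, a.2) else 0) (fun t a => actQ_two hpq.ne t x a.1 a.2)
    (q, j) (p, j)
  simpa [hpq.ne'] using h

/-- `B` slot: the columns `p < 2` of `x_B` vanish on `V(I)` (`R`-family). [folklore] -/
theorem two_col_eq_zero {p q : Fin 3} (hpq : p < q) (i : Fin 3) : x (2, i, p) = 0 := by
  have h := minor_eq_zero_of_line hI 2 _
    (fun t => act_mem_zeroLocus hB isUpperUnit_one isUpperUnit_one (isUpperUnit_transvection hpq t) hx)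
    x (fun a => if a.2 = q then x (2, a.1, p) else 0) (fun t a => actR_two p q t x a.1 a.2)
    (i, p) (i, q)
  simpa [hpq.ne] using h

/-- **`V(I)` lies on the affine cone over the flag point `p₀ = ([E₂₀],[E₀₂],[E₀₂])`**: every non-corner
coordinate vanishes at every point of `V(I)`. [folklore] -/
theorem coord_eq_zero {v : Var} (hv : v ∉ Set.range cornerVar) : x v = 0 := by
  obtain ⟨s, i, j⟩ := v
  obtain hs | hs | hs : s = 0 ∨ s = 1 ∨ s = 2 := (by fin_cases s <;> simp) <;> subst hs
  · by_cases hi : i = 2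
    · subst hi
      have hj : j ≠ 0 := fun hj => hv ⟨0, by simp [cornerVar, hj]⟩
      exact zero_col_eq_zero hI hB hx (Fin.pos_iff_ne_zero.mpr hj) 2
    · exact zero_row_eq_zero hI hB hx (Fin.lt_last_iff_ne_last.mpr hi) j
  · by_cases hi : i = 0
    · subst hi
      have hj : j ≠ 2 := fun hj => hv ⟨1, by simp [cornerVar, hj]⟩
      exact one_col_eq_zero hI hB hx (Fin.lt_last_iff_ne_last.mpr hj) 0
    · exact one_row_eq_zero hI hB hx (Fin.pos_iff_ne_zero.mpr hi) j
  · by_cases hi : i = 0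
    · subst hi
      have hj : j ≠ 2 := fun hj => hv ⟨2, by simp [cornerVar, hj]⟩
      exact two_col_eq_zero hI hB hx (Fin.lt_last_iff_ne_last.mpr hj) 0
    · exact two_row_eq_zero hI hB hx (Fin.pos_iff_ne_zero.mpr hi) j

end Corner

/-- **Borel-stable candidates are supported at the flag point** (registered stub `stub_punctual` of
stmt-MatrixMultiplication-4958, line `punctual-saturation`): for a candidate ideal `I` (generic Hilbert function
of `17` points) stable under `B₃ × B₃ × B₃`, every non-corner coordinate lies in `√(I^{sat})` — in fact in
`√I`, by the Nullstellensatz on the affine cone and `coord_eq_zero`. [folklore] -/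
theorem stub_punctual : ∀ I : Ideal S, IsCandidate I → IsBorelStable I → IsPunctual I := by
  intro I hC hB v hv
  refine Ideal.radical_mono (le_satur I) ?_
  rw [← vanishingIdeal_zeroLocus_eq_radical (K := ℂ)]
  intro x hx
  rw [aeval_X]
  exact coord_eq_zero hC.2.1 hB hx hv

end Summit.MatrixMultiplication.MatrixMultiplication.Theorems.PunctualSaturation

end
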